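import Mathlib.Analysis.CStarAlgebra.Hom
import Literature.MathematicalPhysics.QuantumLattice.SpinSystem
import HarnessLib

/-!
# Discharges for finite quantum spin systems (`SpinSystem`): the local structure of `A ↦ A ⊗ 𝟙`

Trunk **T-QLATTICE**. Sibling proof file of
`Literature/MathematicalPhysics/QuantumLattice/SpinSystem.lean`: it discharges named facts
(`def X : Prop`, D-0014) of that file as `theorem X_holds : X`, from Mathlib and the API already
proved there, and provides the piece of tensor-factor bookkeeping the proofs need. No statement of
`SpinSystem` is changed and no definition is introduced.

Bookkeeping (the product structure `(Λ → Fin q) ≃ (B → Fin q) × (Λ∖B → Fin q)` of the product basis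
of `𝓗_Λ = 𝓗_B ⊗ 𝓗_{Λ∖B}`). A configuration `β` of the region `B` is glued into a configuration
`σ` of `Λ` with Mathlib's `Function.extend Subtype.val β σ` (written `Subtype.val.extend β σ`; it is
`β` on `B` and `σ` off `B`, `Function.extend_val_apply` / `Function.extend_val_apply'`):

* `restrict_extend_val`, `extend_val_restrict_eq_of_forall`, `extend_val_restrict`,
  `extend_val_extend_val`, `forall_extend_val_apply_eq_iff` — rewriting lemmas for glued
  configurations;
* `localOp_mulVec_apply` — **how a local operator acts on vectors**:
  `(localOp B A ψ)(σ) = (A · ψ(· ⊔ σ|_{Λ∖B}))(σ|_B)`, i.e. `A ⊗ 𝟙` acts by `A` on every `B`-slice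
  `β ↦ ψ(β ⊔ σ|_{Λ∖B})` of `ψ`; `localOp_mulVec_extend_val` — the `B`-slices of `localOp B A ψ`
  are `A` applied to those of `ψ`; `localOp_mul_apply` — the same for the columns of a product;
* `localOp_apply_extend_val_of_disjoint`, `localOp_mul_localOp_apply_of_disjoint` — entries of
  (products of) local operators with disjoint supports.

Discharged (all in namespace `Literature.QLattice`):

* `localOp_embedOp_holds : localOp_embedOp` — `(A ⊗ 𝟙_{Y∖X}) ⊗ 𝟙_{Λ∖Y} = A ⊗ 𝟙_{Λ∖X}`;
* `IsSupportedOn.mono_holds : IsSupportedOn.mono` — isotony `𝔄_X ⊆ 𝔄_Y` for `X ⊆ Y`;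
* `isSupportedOn_univ_holds : isSupportedOn_univ` — `𝔄_Λ = 𝔄_univ`;
* `localOp_mul_holds X : localOp_mul X` — `(A ⊗ 𝟙)(B ⊗ 𝟙) = AB ⊗ 𝟙`;
* `IsSupportedOn.mul_holds : IsSupportedOn.mul` — `𝔄_X` is closed under products;
* `localOp_injective_holds X : localOp_injective X` — `A ↦ A ⊗ 𝟙` is injective (`q ≠ 0`);
* `norm_localOp_holds X : norm_localOp X` — `‖A ⊗ 𝟙‖ = ‖A‖` (`q ≠ 0`);
* `commute_of_disjoint_holds : commute_of_disjoint` — **locality**, `[𝔄_X, 𝔄_Y] = 0` for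
  `X ∩ Y = ∅`;
* `onSite_eq_localOp_holds : onSite_eq_localOp`, `isSupportedOn_onSite_holds :
  isSupportedOn_onSite`, `siteSpin_commute_of_ne_holds : siteSpin_commute_of_ne`.

## Sources

* O. Bratteli, D. W. Robinson, *Operator Algebras and Quantum Statistical Mechanics II*
  (2nd ed., Springer 1997), §6.2.1: quantum spin systems, `𝓗_{Λ₁∪Λ₂} = 𝓗_{Λ₁} ⊗ 𝓗_{Λ₂}`,
  `𝔄_{Λ₁} ≅ 𝔄_{Λ₁} ⊗ 𝟙_{Λ₂}` for `Λ₁ ⊆ Λ₁ ∪ Λ₂` (isotony; an injective `*`-morphism, hence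
  isometric) and commutativity of `𝔄_{Λ₁}`, `𝔄_{Λ₂}` for `Λ₁ ∩ Λ₂ = ∅` (locality).
  [BratteliRobinsonII1997]
* B. Nachtergaele, R. Sims, *Lieb–Robinson bounds and the exponential clustering theorem*,
  Comm. Math. Phys. **265** (2006) 119–130, §2 (`A ↦ A ⊗ 𝟙` identifies `𝔄_X ⊆ 𝔄_Λ`).
  [NachtergaeleSims2006]
* H. Tasaki, *Physics and Mathematics of Quantum Many-Body Systems* (Springer 2020), §2.2,
  eqs. (2.2.5)–(2.2.6) (single-site operators, `[S_x^α, S_y^β] = 0` for `x ≠ y`). [Tasaki2020]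

## Proof sketch

Everything is entrywise linear algebra in the product basis `|σ⟩`, `σ : Λ → Fin q`, using the
defining formula `⟨σ|localOp B A|τ⟩ = [σ = τ off B] · A(σ|_B, τ|_B)`. The one non-trivial
reindexing is `localOp_mulVec_apply`: the configurations `τ` agreeing with `σ` off `B` are
exactly the glued `Subtype.val.extend β σ`, `β : B → Fin q`, injectively in `β`
(`Function.extend_injective`, `Finset.sum_map` + `Finset.sum_subset`). Products
(`localOp_mul_holds`, `commute_of_disjoint_holds`) are then read off from
`(M N)(σ, τ) = (M · N(·, τ))(σ)`. The norm identity `‖A ⊗ 𝟙‖ = ‖A‖` is Mathlib's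
`NonUnitalStarAlgHom.norm_map` (an injective `*`-homomorphism of C⋆-algebras is isometric)
applied to the unital `*`-homomorphism `A ↦ A ⊗ 𝟙` between the matrix C⋆-algebras (L²-operator
norm, `Matrix.instCStarRing`), which is injective by `localOp_injective_holds`.
-/

noncomputable section

open Matrix Complex Finset
open scoped Matrix.Norms.L2Operator

namespace Literature.MathematicalPhysics.QuantumLattice

variable {Λ : Type*} {q : ℕ}

/-! ### Gluing configurations along a region (`Subtype.val.extend β σ`) -/

section Glue

variable (B : Finset Λ)

/-- The restriction to `B` of the glued configuration `β ⊔ σ|_{Λ∖B}` is `β`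
(`Function.extend_comp` in `funext` form). Bratteli–Robinson II §6.2.1
(`𝓗_{Λ₁∪Λ₂} = 𝓗_{Λ₁} ⊗ 𝓗_{Λ₂}`). [folklore] -/
theorem restrict_extend_val (β : B → Fin q) (σ : TensorIndex Λ q) :
    (fun x : B => Subtype.val.extend β σ x) = β :=
  funext fun x => Subtype.val_injective.extend_apply β σ x

/-- A configuration `τ` agreeing with `σ` off `B` is `σ` glued with the restriction `τ|_B`.
[folklore] -/
theorem extend_val_restrict_eq_of_forall {σ τ : TensorIndex Λ q} (h : ∀ y, y ∉ B → σ y = τ y) :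
    Subtype.val.extend (fun x : B => τ x) σ = τ := by
  funext x
  by_cases hx : x ∈ B
  · exact Function.extend_val_apply hx
  · rw [Function.extend_val_apply' hx, h x hx]

/-- Gluing the restriction `σ|_B` back into `σ` gives `σ`. [folklore] -/
@[simp]
theorem extend_val_restrict (σ : TensorIndex Λ q) :
    Subtype.val.extend (fun x : B => σ x) σ = σ :=
  extend_val_restrict_eq_of_forall B fun _ _ => rfl

/-- Gluing twice along the same region keeps the last glued configuration. [folklore] -/
@[simp]
theorem extend_val_extend_val (β β' : B → Fin q) (σ : TensorIndex Λ q) :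
    Subtype.val.extend β (Subtype.val.extend β' σ) = Subtype.val.extend β σ := by
  funext x
  by_cases hx : x ∈ B
  · rw [Function.extend_val_apply hx, Function.extend_val_apply hx]
  · rw [Function.extend_val_apply' hx, Function.extend_val_apply' hx,
      Function.extend_val_apply' hx]

/-- `β ⊔ σ|_{Λ∖B}` agrees with `τ` off `B` iff `σ` does. [folklore] -/
theorem forall_extend_val_apply_eq_iff (β : B → Fin q) (σ τ : TensorIndex Λ q) :
    (∀ y, y ∉ B → Subtype.val.extend β σ y = τ y) ↔ ∀ y, y ∉ B → σ y = τ y :=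
  forall₂_congr fun _ hy => by rw [Function.extend_val_apply' hy]

end Glue

variable [Fintype Λ] [DecidableEq Λ]

/-! ### How local operators act on vectors -/

/-- **Action of a local operator.** `A ⊗ 𝟙_{Λ∖B}` acts on the `B`-slices of a vector:
`(localOp B A ψ)(σ) = Σ_β A(σ|_B, β) ψ(β ⊔ σ|_{Λ∖B}) = (A · ψ(· ⊔ σ|_{Λ∖B}))(σ|_B)`.
Bratteli–Robinson II §6.2.1 (`𝔄_{Λ₁} ≅ 𝔄_{Λ₁} ⊗ 𝟙`). [folklore] -/
theorem localOp_mulVec_apply (B : Finset Λ) (A : Matrix (B → Fin q) (B → Fin q) ℂ)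
    (ψ : TensorIndex Λ q → ℂ) (σ : TensorIndex Λ q) :
    (localOp B A *ᵥ ψ) σ = (A *ᵥ fun β => ψ (Subtype.val.extend β σ)) fun x => σ x := by
  simp only [Matrix.mulVec, dotProduct]
  symm
  calc ∑ β, A (fun x : B => σ x) β * ψ (Subtype.val.extend β σ)
      = ∑ β, localOp B A σ (Subtype.val.extend β σ) * ψ (Subtype.val.extend β σ) := by
        refine Finset.sum_congr rfl fun β _ => ?_
        rw [localOp_apply, if_pos fun y hy => (Function.extend_val_apply' hy).symm,
          restrict_extend_val]
    _ = ∑ τ ∈ (univ : Finset (B → Fin q)).map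
            ⟨_, Function.extend_injective Subtype.val_injective σ⟩, localOp B A σ τ * ψ τ :=
        (Finset.sum_map _ ⟨_, Function.extend_injective Subtype.val_injective σ⟩
          fun τ => localOp B A σ τ * ψ τ).symm
    _ = ∑ τ, localOp B A σ τ * ψ τ := by
        refine Finset.sum_subset (Finset.subset_univ _) fun τ _ hτ => ?_
        rw [localOp_apply, if_neg, zero_mul]
        intro hστ
        exact hτ (Finset.mem_map.2 ⟨fun x : B => τ x, Finset.mem_univ _,
          extend_val_restrict_eq_of_forall B hστ⟩)

/-- The `B`-slices of `localOp B A ψ` are `A` applied to the `B`-slices of `ψ`: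
`(β ↦ (localOp B A ψ)(β ⊔ σ|_{Λ∖B})) = A · (β ↦ ψ(β ⊔ σ|_{Λ∖B}))` (`localOp_mulVec_apply` at a
glued configuration). Bratteli–Robinson II §6.2.1 (`A ⊗ 𝟙` acts on the factor `𝓗_B`). [folklore] -/
theorem localOp_mulVec_extend_val (B : Finset Λ) (A : Matrix (B → Fin q) (B → Fin q) ℂ)
    (ψ : TensorIndex Λ q → ℂ) (σ : TensorIndex Λ q) :
    (fun β => (localOp B A *ᵥ ψ) (Subtype.val.extend β σ)) =
      A *ᵥ fun β => ψ (Subtype.val.extend β σ) := by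
  funext β
  rw [localOp_mulVec_apply]
  simp only [extend_val_extend_val, restrict_extend_val]

/-- Entries of a product with a local operator on the left:
`(localOp B A · N)(σ, τ) = (A · N(· ⊔ σ|_{Λ∖B}, τ))(σ|_B)`. [folklore] -/
theorem localOp_mul_apply (B : Finset Λ) (A : Matrix (B → Fin q) (B → Fin q) ℂ) (N : Op Λ q)
    (σ τ : TensorIndex Λ q) :
    (localOp B A * N) σ τ = (A *ᵥ fun β => N (Subtype.val.extend β σ) τ) fun x => σ x := by
  rw [← localOp_mulVec_apply B A (fun υ => N υ τ) σ, Matrix.mul_apply']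
  rfl

/-! ### Isotony -/

/-- **Discharge** of the named fact `localOp_embedOp`:
`(A ⊗ 𝟙_{Y∖X}) ⊗ 𝟙_{Λ∖Y} = A ⊗ 𝟙_{Λ∖X}` for `X ⊆ Y` (entrywise: `σ = τ` off `X` iff `σ = τ`
off `Y` and on `Y∖X`). Bratteli–Robinson II §6.2.1 (isotony). [cite: BratteliRobinsonII1997, §6.2.1] -/
theorem localOp_embedOp_holds : localOp_embedOp (Λ := Λ) (q := q) := by
  intro X Y h A
  ext σ τ
  simp only [localOp_apply, embedOp, of_apply]
  by_cases hX : ∀ y, y ∉ X → σ y = τ y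
  · have hY : ∀ y, y ∉ Y → σ y = τ y := fun y hy => hX y fun hyX => hy (h hyX)
    have hXY : ∀ y : Y, (y : Λ) ∉ X → σ y = τ y := fun y hy => hX y hy
    rw [if_pos hX, if_pos hY, if_pos hXY]
  · rw [if_neg hX]
    by_cases hY : ∀ y, y ∉ Y → σ y = τ y
    · rw [if_pos hY, if_neg]
      intro hXY
      exact hX fun y hy => if hyY : y ∈ Y then hXY ⟨y, hyY⟩ hy else hY y hyY
    · rw [if_neg hY]

/-- **Discharge** of the named fact `IsSupportedOn.mono` (isotony `𝔄_X ⊆ 𝔄_Y` for `X ⊆ Y`), from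
`localOp_embedOp_holds`. Bratteli–Robinson II §6.2.1. [cite: BratteliRobinsonII1997, §6.2.1] -/
theorem IsSupportedOn.mono_holds : IsSupportedOn.mono (Λ := Λ) (q := q) := by
  intro A X Y hA h
  obtain ⟨A, rfl⟩ := hA
  exact ⟨embedOp h A, localOp_embedOp_holds h A⟩

/-- **Discharge** of the named fact `isSupportedOn_univ`: every observable is `localOp univ` of
itself relabelled along `↥univ ≃ Λ`. Bratteli–Robinson II §6.2.1. [cite: BratteliRobinsonII1997, §6.2.1] -/
theorem isSupportedOn_univ_holds : isSupportedOn_univ (Λ := Λ) (q := q) := by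
  intro A
  refine ⟨fun α β => A (fun x => α ⟨x, Finset.mem_univ x⟩) fun x => β ⟨x, Finset.mem_univ x⟩,
    ?_⟩
  ext σ τ
  rw [localOp_apply, if_pos fun y hy => absurd (Finset.mem_univ y) hy]

/-! ### Products -/

/-- **Discharge** of the named fact `localOp_mul`: `A ↦ A ⊗ 𝟙` is multiplicative,
`(A ⊗ 𝟙)(B ⊗ 𝟙) = AB ⊗ 𝟙` (from `localOp_mul_apply`: the `X`-slices of a column of `B ⊗ 𝟙`
are `[σ = τ off X] · B(·, τ|_X)`). Bratteli–Robinson II §6.2.1. [cite: BratteliRobinsonII1997, §6.2.1] -/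
theorem localOp_mul_holds (X : Finset Λ) : localOp_mul (q := q) X := by
  intro A B
  ext σ τ
  rw [localOp_mul_apply]
  have h2 : (fun β => localOp X B (Subtype.val.extend β σ) τ) =
      fun β => if (∀ y, y ∉ X → σ y = τ y) then B β (fun x => τ x) else 0 := by
    funext β
    rw [localOp_apply, restrict_extend_val,
      if_congr (forall_extend_val_apply_eq_iff X β σ τ) rfl rfl]
  rw [h2, localOp_apply]
  by_cases hC : ∀ y, y ∉ X → σ y = τ y
  · simp only [if_pos hC]
    rfl
  · simp only [if_neg hC]
    simp [Matrix.mulVec, dotProduct]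

/-- **Discharge** of the named fact `IsSupportedOn.mul` (`𝔄_X` is closed under products), from
`localOp_mul_holds`. Bratteli–Robinson II §6.2.1. [cite: BratteliRobinsonII1997, §6.2.1] -/
theorem IsSupportedOn.mul_holds : IsSupportedOn.mul (Λ := Λ) (q := q) := by
  intro A B X hA hB
  obtain ⟨A, rfl⟩ := hA
  obtain ⟨B, rfl⟩ := hB
  exact ⟨A * B, localOp_mul_holds X A B⟩

/-- **Discharge** of the named fact `localOp_injective`: for `q ≠ 0` the entries of `A` are read
off from `A ⊗ 𝟙` at glued configurations, `A(α, β) = ⟨α ⊔ 0|A ⊗ 𝟙|β ⊔ 0⟩`.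
Bratteli–Robinson II §6.2.1. [cite: BratteliRobinsonII1997, §6.2.1] -/
theorem localOp_injective_holds (X : Finset Λ) : localOp_injective (q := q) X := by
  intro _ A A' h
  ext α β
  let σ₀ : TensorIndex Λ q := fun _ => 0
  have hc : ∀ y, y ∉ X → Subtype.val.extend α σ₀ y = Subtype.val.extend β σ₀ y := fun y hy => by
    rw [Function.extend_val_apply' hy, Function.extend_val_apply' hy]
  have h1 := congrFun (congrFun h (Subtype.val.extend α σ₀)) (Subtype.val.extend β σ₀)
  rw [localOp_apply, localOp_apply, if_pos hc, if_pos hc] at h1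
  simpa only [restrict_extend_val] using h1

/-- **Discharge** of the named fact `norm_localOp`: `‖A ⊗ 𝟙‖ = ‖A‖` in the L²-operator norms
(`q ≠ 0`). `A ↦ A ⊗ 𝟙` is a unital `*`-homomorphism (`localOp_one/mul/add/smul/conjTranspose`)
between the matrix C⋆-algebras and is injective (`localOp_injective_holds`); an injective
`*`-homomorphism of C⋆-algebras is isometric (Mathlib's `NonUnitalStarAlgHom.norm_map`).
Nachtergaele–Sims (2006) §2; Bratteli–Robinson II §6.2.1. [cite: NachtergaeleSims2006, §2] -/
theorem norm_localOp_holds (X : Finset Λ) : norm_localOp (q := q) X := by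
  intro _ A
  letI : CStarAlgebra (Op Λ q) := {}
  letI : CStarAlgebra (Matrix (X → Fin q) (X → Fin q) ℂ) := {}
  let f : Matrix (X → Fin q) (X → Fin q) ℂ →⋆ₐ[ℂ] Op Λ q :=
    { toFun := localOp X
      map_one' := localOp_one X
      map_mul' := localOp_mul_holds X
      map_zero' := localOp_zero X
      map_add' := localOp_add X
      commutes' := fun c => by
        simp only [Algebra.algebraMap_eq_smul_one, localOp_smul, localOp_one]
      map_star' := localOp_conjTranspose X }
  exact NonUnitalStarAlgHom.norm_map f (localOp_injective_holds X) A

/-! ### Locality -/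

/-- Entries of `C ⊗ 𝟙_{Λ∖Y}` at a row glued along a region `X` disjoint from `Y`:
`⟨β ⊔ σ|_{Λ∖X}| C ⊗ 𝟙 |τ⟩ = [β = τ|_X] [σ = τ off X ∪ Y] · C(σ|_Y, τ|_Y)`.
Bratteli–Robinson II §6.2.1 (locality). [folklore] -/
theorem localOp_apply_extend_val_of_disjoint {X Y : Finset Λ} (hXY : Disjoint X Y)
    (C : Matrix (Y → Fin q) (Y → Fin q) ℂ) (β : X → Fin q) (σ τ : TensorIndex Λ q) :
    localOp Y C (Subtype.val.extend β σ) τ =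
      if β = (fun x : X => τ x) ∧ ∀ y, y ∉ X → y ∉ Y → σ y = τ y then
        C (fun y => σ y) (fun y => τ y) else 0 := by
  rw [localOp_apply]
  have hres : (fun y : Y => Subtype.val.extend β σ y) = fun y : Y => σ y :=
    funext fun y => Function.extend_val_apply' (Finset.disjoint_right.1 hXY y.2)
  rw [hres]
  refine if_congr ⟨fun h => ⟨funext fun x => ?_, fun y hyX hyY => ?_⟩, fun h y hyY => ?_⟩ rfl rfl
  · have := h x (Finset.disjoint_left.1 hXY x.2)
    rwa [Subtype.val_injective.extend_apply] at this
  · have := h y hyY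
    rwa [Function.extend_val_apply' hyX] at this
  · by_cases hyX : y ∈ X
    · rw [Function.extend_val_apply hyX, h.1]
    · rw [Function.extend_val_apply' hyX, h.2 y hyX hyY]

/-- Entries of the product of two local operators with disjoint supports:
`⟨σ|(A ⊗ 𝟙)(C ⊗ 𝟙)|τ⟩ = [σ = τ off X ∪ Y] · A(σ|_X, τ|_X) C(σ|_Y, τ|_Y)` for `X ∩ Y = ∅`.
Bratteli–Robinson II §6.2.1 (locality). [folklore] -/
theorem localOp_mul_localOp_apply_of_disjoint {X Y : Finset Λ} (hXY : Disjoint X Y)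
    (A : Matrix (X → Fin q) (X → Fin q) ℂ) (C : Matrix (Y → Fin q) (Y → Fin q) ℂ)
    (σ τ : TensorIndex Λ q) :
    (localOp X A * localOp Y C) σ τ =
      if ∀ y, y ∉ X → y ∉ Y → σ y = τ y then
        A (fun x => σ x) (fun x => τ x) * C (fun y => σ y) (fun y => τ y) else 0 := by
  rw [localOp_mul_apply]
  simp only [localOp_apply_extend_val_of_disjoint hXY, Matrix.mulVec, dotProduct, ite_and,
    mul_ite, mul_zero, Finset.sum_ite_eq', Finset.mem_univ, if_true]

/-- **Discharge** of the named fact `commute_of_disjoint` (**locality**): observables with disjoint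
supports commute, `[𝔄_X, 𝔄_Y] = 0` for `X ∩ Y = ∅`; both products have the entries
`[σ = τ off X ∪ Y] · A(σ|_X, τ|_X) C(σ|_Y, τ|_Y)` (`localOp_mul_localOp_apply_of_disjoint`).
Bratteli–Robinson II §6.2.1; Nachtergaele–Sims (2006) §2. [cite: NachtergaeleSims2006, §2] -/
theorem commute_of_disjoint_holds : commute_of_disjoint (Λ := Λ) (q := q) := by
  intro A B X Y hA hB h
  obtain ⟨A, rfl⟩ := hA
  obtain ⟨B, rfl⟩ := hB
  refine Matrix.ext fun σ τ => ?_
  rw [localOp_mul_localOp_apply_of_disjoint h, localOp_mul_localOp_apply_of_disjoint h.symm,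
    mul_comm]
  exact if_congr ⟨fun h' y hyY hyX => h' y hyX hyY, fun h' y hyX hyY => h' y hyY hyX⟩ rfl rfl

/-! ### Single-site operators -/

/-- **Discharge** of the named fact `onSite_eq_localOp`: a single-site operator at `x` is the local
operator on `{x}` obtained by transporting `a` along `({x} → Fin q) ≃ Fin q` (entrywise, the
default element of `↥{x}` being `x`). Tasaki (2020) §2.2, eq. (2.2.5). [cite: Tasaki2020, §2.2 eq. (2.2.5)] -/
theorem onSite_eq_localOp_holds : onSite_eq_localOp (Λ := Λ) (q := q) := by
  intro x a
  ext σ τ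
  have hd : ((default : ({x} : Finset Λ)) : Λ) = x :=
    Finset.mem_singleton.1 (default : ({x} : Finset Λ)).2
  simp only [onSite_apply, localOp_apply, Matrix.reindex_apply, Matrix.submatrix_apply,
    Equiv.symm_symm, Equiv.funUnique_apply, hd, Finset.mem_singleton, ne_eq]

/-- **Discharge** of the named fact `isSupportedOn_onSite` (single-site operators are supported on
`{x}`), from `onSite_eq_localOp_holds`. Tasaki (2020) §2.2. [cite: Tasaki2020, §2.2 eq. (2.2.5)] -/
theorem isSupportedOn_onSite_holds : isSupportedOn_onSite (Λ := Λ) (q := q) :=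
  fun x a => ⟨_, (onSite_eq_localOp_holds x a).symm⟩

/-- **Discharge** of the named fact `siteSpin_commute_of_ne`: spin operators at distinct sites
commute, `[S^α_x, S^β_y] = 0` for `x ≠ y` (locality for the disjoint supports `{x}`, `{y}`; this
is the interim proof preserved in `SpinSystem`). Tasaki (2020) §2.2, eq. (2.2.6). [cite: Tasaki2020, §2.2 eq. (2.2.6)] -/
theorem siteSpin_commute_of_ne_holds : siteSpin_commute_of_ne (Λ := Λ) :=
  fun n _ _ hxy α β =>
    commute_of_disjoint_holds (isSupportedOn_onSite_holds _ (spinVec n α))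
      (isSupportedOn_onSite_holds _ (spinVec n β)) (Finset.disjoint_singleton.mpr hxy)

end Literature.MathematicalPhysics.QuantumLattice
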